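import Literature.Combinatorics.Enumerative.SporadicSupercongruenceHalfBlockProofs
import Literature.Combinatorics.Enumerative.MultivariateAperyDigitReductionProofs
import Mathlib.Tactic
import HarnessLib

/-!
# Osburn–Sahu–Straub 2016, Lemma 2.5 (A = 2) and the induction (sumCs0): `Σ' k⁻² 𝒞(mp^{r−s},[k/p^s],[2k/p^s]) ≡ 0 (mod p^r)`

Topic `Literature/Combinatorics/Enumerative`, namespace `Literature.Combinatorics.Enumerative.SporadicSupercongruenceProofs`
(third file of the chain `…TermProofs` / `…HalfBlockProofs` → `…CompanionProofs` → `…GZeroProofs` → `…Proofs`,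
which DISCHARGES the named fact `AperyGaussCongruences.oss2016_theorem12`). PROOF FILE: sorry-free theorems only —
no definition, no named fact. Source read on the page (held `paper:arxiv-1312.2195`, §2 pp. 5–6): R. Osburn, B. Sahu,
A. Straub, *Supercongruences for sporadic sequences*, Proc. Edinb. Math. Soc. **59** (2016) 503–518
[OsburnSahuStraub2016]. Lemma 2.4 is the tree's `MultivariateAperyNumbers.lemma54` (Straub 2014, Lemma 5.4) and
(eq. binomind2) is the tree's `MultivariateAperyPrimePowerProofs.choose_add_modEq`. HONEST FRAMING (cell pub-zeta5):
classical `p`-adic congruences for binomial sums; nothing here concerns `ζ(5)`.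

## What is printed (verbatim, [OsburnSahuStraub2016] §2)

«Lemma 2.4. For primes `p`, integers `m` and integers `k ≥ 0`, `r ≥ 1`,
`C(mp^r − 1, k)(−1)^k ≡ C(mp^{r−1} − 1, [k/p])(−1)^{[k/p]} (mod p^r)`.»
«Lemma 2.5. For integers `n, k, j` and `A, B, C ≥ 0`, define (Cnkj)
`𝒞(n, k, j) = 𝒞(n, k, j; A,B,C) = C(n−1,k)^A C(n+k,k)^B C(j,n)^C`. Then, for primes `p` and integers
`n, k, j ≥ 0`, `r ≥ 1`, `𝒞(np^r, k, j) ≡ (−1)^{(k+[k/p])A} 𝒞(np^{r−1}, [k/p], [j/p]) (mod p^r)`. Proof. … (binomind2)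
`C(np^r + k, k) ≡ C(np^{r−1} + [k/p], [k/p]) (mod p^r)`. In particular … which is equivalent to (CindC)
`C(j, np^r) ≡ C([j/p], np^{r−1}) (mod p^r)`.»
Proof of Theorem 1.2 (the case `A = 2`): «we now show that (sumCs0)
`Σ'_k (1/k²) 𝒞(mp^r, k, 2k) ≡ Σ'_k (1/k²) 𝒞(mp^{r−s}, [k/p^s], [2k/p^s]) (mod p^r)` for `s = 0, 1, …, r`. …
It follows from (8) of Lemma 2.2 that each of the inner sums in the last expression of (sumCsx) is divisible by
`p^s`. Suppose that `s < r`. Thus, by (sumCsx) and Lemma 2.5, we now have … `≡ Σ'_k (1/k²) 𝒞(mp^{r−s−1},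
[k/p^{s+1}], [2k/p^{s+1}]) (mod p^r)`. Hence (sumCs0) follows by induction on `s`. Moreover, the case `s = r` in
(sumCsx) shows that, for `s = r` and hence all `s = 0, 1, …, r`, the sums in (sumCs0) are divisible by `p^r`.»

## What is proved (natural arguments; `A = 2`, so the sign `(−1)^{(k+[k/p])A}` is `1`)

* `choose_bottom_modEq` — (CindC) for all `j ≥ 0` (both sides vanish when `j < np^r`);
* **`companionS_modEq`** — Lemma 2.5 for `𝒞(n,k,j; 2,B,C)` (`n = m ≥ 1`), from `lemma54²`, `choose_add_modEq^B`,
  `choose_bottom_modEq^C`;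
* **`pow_dvd_weighted_companion_sum`** — «the sums in (sumCs0) are divisible by `p^r`» for every `s ≤ r`, indexed
  by `t = r − s`: `p^r ∣ Σ_{k < mp^r} a_k 𝒞(mp^t, [k/p^{r−t}], [2k/p^{r−t}])` in `ℤ_p` (`a_k = k⁻²`, `p ∤ k`;
  `0`, `p ∣ k`), by induction on `t` with `…HalfBlockProofs.pow_dvd_weighted_block_sum`.
-/

open Finset

namespace Literature.Combinatorics.Enumerative.SporadicSupercongruenceProofs

open MultivariateAperyNumbers (lemma54)
open MultivariateAperyPrimePowerProofs (choose_add_modEq)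

/-! ### §1. Lemma 2.5 for `A = 2` -/

section Companion

/-- **(CindC)**: for a prime `p`, `ρ ≥ 1` and all `m, j ≥ 0`, `C(j, p^ρ m) ≡ C([j/p], p^{ρ−1} m) (mod p^ρ)`
(printed from (binomind2) at `k = j − np^r`; for `j < mp^ρ` both binomials vanish).
[cite: OsburnSahuStraub2016, Lemma 2.5 (proof, (CindC))] -/
theorem choose_bottom_modEq {p : ℕ} (hp : p.Prime) {ρ : ℕ} (hρ : 1 ≤ ρ) (m j : ℕ) :
    ((j.choose (p ^ ρ * m) : ℕ) : ℤ) ≡ ((j / p).choose (p ^ (ρ - 1) * m) : ℕ) [ZMOD (p : ℤ) ^ ρ] := by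
  have hp0 : 0 < p := hp.pos
  set N := p ^ (ρ - 1) * m with hN
  have hpN : p ^ ρ * m = p * N := by
    rw [hN, ← mul_assoc, ← pow_succ']; congr 2; omega
  rw [hpN]
  rcases Nat.lt_or_ge j (p * N) with hj | hj
  · have h1 : j / p < N := Nat.div_lt_of_lt_mul hj
    rw [Nat.choose_eq_zero_of_lt hj, Nat.choose_eq_zero_of_lt h1]
  · obtain ⟨i, rfl⟩ := Nat.exists_eq_add_of_le hj
    have hdiv : p ^ ρ ∣ p * N := ⟨m, by rw [← hpN]⟩
    have h := choose_add_modEq hp ρ hdiv i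
    rw [Nat.mul_add_div hp0, Nat.choose_symm_add, Nat.choose_symm_add]
    exact h

/-- Squares kill the signs of Lemma 2.4: `((−1)^n a)² = a²`. [folklore] -/
private theorem neg_one_pow_mul_sq (n : ℕ) (a : ℤ) : ((-1) ^ n * a) ^ 2 = a ^ 2 := by
  rw [mul_pow, ← pow_mul, mul_comm n 2, pow_mul, neg_one_sq, one_pow, one_mul]

/-- **Osburn–Sahu–Straub 2016, Lemma 2.5 for `A = 2`**: for a prime `p`, `ρ ≥ 1`, `m ≥ 1` and all `n, j ≥ 0`,
`𝒞(mp^ρ, n, j) ≡ 𝒞(mp^{ρ−1}, [n/p], [j/p]) (mod p^ρ)` for `𝒞(M, n, j) = C(M−1,n)² C(M+n,n)^B C(j,M)^C`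
(the sign `(−1)^{2(n+[n/p])}` is `1`). Route as printed: Lemma 2.4 (tree `lemma54`) squared, (binomind2) (tree
`choose_add_modEq`) to the power `B`, (CindC) to the power `C`. [cite: OsburnSahuStraub2016, Lemma 2.5] -/
theorem companionS_modEq {p : ℕ} (hp : p.Prime) (B C : ℕ) {ρ : ℕ} (hρ : 1 ≤ ρ) {m : ℕ} (hm : 1 ≤ m)
    (n j : ℕ) :
    ((((p ^ ρ * m - 1).choose n) ^ 2 * ((p ^ ρ * m + n).choose n) ^ B * (j.choose (p ^ ρ * m)) ^ C : ℕ) : ℤ) ≡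
      ((((p ^ (ρ - 1) * m - 1).choose (n / p)) ^ 2 * ((p ^ (ρ - 1) * m + n / p).choose (n / p)) ^ B *
        ((j / p).choose (p ^ (ρ - 1) * m)) ^ C : ℕ) : ℤ) [ZMOD (p : ℤ) ^ ρ] := by
  have h1 := (lemma54 hp hρ hm n).pow 2
  rw [neg_one_pow_mul_sq, neg_one_pow_mul_sq] at h1
  have h3 := (choose_bottom_modEq hp hρ m j).pow C
  set N := p ^ (ρ - 1) * m with hN
  have hpN : p ^ ρ * m = p * N := by
    rw [hN, ← mul_assoc, ← pow_succ']; congr 2; omega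
  have hdiv : p ^ ρ ∣ p * N := ⟨m, by rw [← hpN]⟩
  have h2 := (choose_add_modEq hp ρ hdiv n).pow B
  rw [hpN] at h1 h3 ⊢
  have := (h1.mul h2).mul h3
  push_cast at this ⊢
  exact this

end Companion

/-! ### §2. The induction (sumCs0): all the sums `Σ' k⁻² 𝒞(mp^{r−s}, [k/p^s], [2k/p^s])` are divisible by `p^r` -/

section Chain

variable {p : ℕ} [hp : Fact p.Prime]

/-- An integer congruence of naturals as a divisibility in `ℤ_p`. [folklore] -/
private theorem padicInt_pow_dvd_sub_of_modEq {ρ a b : ℕ} (h : (a : ℤ) ≡ b [ZMOD (p : ℤ) ^ ρ]) :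
    (p : ℤ_[p]) ^ ρ ∣ (a : ℤ_[p]) - (b : ℤ_[p]) := by
  obtain ⟨c, hc⟩ := Int.ModEq.dvd h.symm
  refine ⟨(c : ℤ_[p]), ?_⟩
  have := congrArg (Int.cast : ℤ → ℤ_[p]) hc
  push_cast at this
  exact this

/-- `d ∣ a`, `d ∣ b`, `c = a + b` ⟹ `d ∣ c`. [folklore] -/
private theorem dvd_of_eq_add_oss {α : Type*} [CommRing α] {d a b c : α} (ha : d ∣ a) (hb : d ∣ b)
    (h : c = a + b) : d ∣ c := h ▸ dvd_add ha hb

/-- **«the sums in (sumCs0) are divisible by `p^r`»** (OSS, proof of Theorem 1.2, `A = 2`), indexed by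
`t = r − s`: for a prime `p ≥ 5`, `m ≥ 1` and every `t ≤ r`,
`p^r ∣ Σ_{0 ≤ k < mp^r} a_k · 𝒞(mp^t, [k/p^{r−t}], [2k/p^{r−t}])` in `ℤ_p`, where `a_k = k⁻²` (`p ∤ k`), `0` (`p ∣ k`)
and `𝒞(M,n,j) = C(M−1,n)² C(M+n,n)^B C(j,M)^C`. Printed induction: the base `t = 0` (`s = r`) and the step
`s + 1 → s` are both `…HalfBlockProofs.pow_dvd_weighted_block_sum` (half-block weight sums divisible by `p^s`), the
step with Lemma 2.5's `p^{r−s} ∣ 𝒞(mp^{r−s}, n, j) − 𝒞(mp^{r−s−1}, [n/p], [j/p])`.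
[cite: OsburnSahuStraub2016, Theorem 1.2 (proof, (sumCs0)–(sumCsx))] -/
theorem pow_dvd_weighted_companion_sum (h5 : 5 ≤ p) (B C : ℕ) (r : ℕ) {m : ℕ} (hm : 1 ≤ m) :
    ∀ t : ℕ, t ≤ r → (p : ℤ_[p]) ^ r ∣ ∑ k ∈ range (p ^ r * m),
      (Ring.inverse ((k : ℤ_[p]))) ^ 2 *
        ((((p ^ t * m - 1).choose (k / p ^ (r - t))) ^ 2 *
          ((p ^ t * m + k / p ^ (r - t)).choose (k / p ^ (r - t))) ^ B *
          ((2 * k / p ^ (r - t)).choose (p ^ t * m)) ^ C : ℕ) : ℤ_[p]) := by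
  have hp' := hp.out
  intro t
  induction t with
  | zero =>
    intro _
    rw [Nat.sub_zero, show p ^ r * m = m * p ^ r by ring]
    have h := pow_dvd_weighted_block_sum (p := p) h5 r 0 m
      (fun n j => ((((p ^ 0 * m - 1).choose n) ^ 2 * ((p ^ 0 * m + n).choose n) ^ B *
        (j.choose (p ^ 0 * m)) ^ C : ℕ) : ℤ_[p])) (fun n j => by rw [pow_zero]; exact one_dvd _)
    rwa [zero_add] at h
  | succ t ih =>
    intro ht
    have ih' := ih (by omega)
    set s := r - (t + 1) with hs
    have hrt : r - t = s + 1 := by omega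
    rw [hrt] at ih'
    -- the difference of the two sums is `Σ_k a_k · G([k/p^s], [2k/p^s])` with `p^{t+1} ∣ G`
    have hG : ∀ n j : ℕ, (p : ℤ_[p]) ^ (t + 1) ∣
        ((((p ^ (t + 1) * m - 1).choose n) ^ 2 * ((p ^ (t + 1) * m + n).choose n) ^ B *
            (j.choose (p ^ (t + 1) * m)) ^ C : ℕ) : ℤ_[p]) -
          ((((p ^ t * m - 1).choose (n / p)) ^ 2 * ((p ^ t * m + n / p).choose (n / p)) ^ B *
            ((j / p).choose (p ^ t * m)) ^ C : ℕ) : ℤ_[p]) := by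
      intro n j
      have h := companionS_modEq hp' B C (show 1 ≤ t + 1 by omega) hm n j
      rw [Nat.add_sub_cancel] at h
      exact padicInt_pow_dvd_sub_of_modEq h
    have hdiff := pow_dvd_weighted_block_sum (p := p) h5 s (t + 1) (p ^ (t + 1) * m) _ hG
    have hrange : p ^ (t + 1) * m * p ^ s = p ^ r * m := by
      rw [mul_right_comm, ← pow_add, show t + 1 + s = r by omega]
    rw [hrange, show t + 1 + s = r by omega] at hdiff
    have hdigit : ∀ k : ℕ, k / p ^ (s + 1) = k / p ^ s / p := fun k => by
      rw [pow_succ, Nat.div_div_eq_div_mul]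
    refine dvd_of_eq_add_oss ih' hdiff ?_
    rw [← Finset.sum_add_distrib]
    refine Finset.sum_congr rfl fun k _ => ?_
    rw [hdigit k, hdigit (2 * k)]
    ring

end Chain

end Literature.Combinatorics.Enumerative.SporadicSupercongruenceProofs
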